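import Summits.ResolutionOfSingularities.ResolutionOfSingularities.Theorems.ValuativeLuAlphaPTorsorCurveMonomialization
import Summits.ResolutionOfSingularities.ResolutionOfSingularities.Theorems.ValuativeLuAlphaPTorsorContentSandwich
import Summits.ResolutionOfSingularities.ResolutionOfSingularities.Theorems.ValuativeLuAlphaPTorsorPrimeDichotomy
import Summits.ResolutionOfSingularities.ResolutionOfSingularities.Theorems.ValuativeLuAlphaPTorsorGcdBookkeeping

/-!
# Phase one of Giraud's Théorème 2.4 along the quadratic sequence

Helper file for the stub `giraud_phase_one` (P1) of the line `pfaff-line-log-final-forms`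
(crux `Valuative.LuAlphaPTorsor`, item `stmt-ResolutionOfSingularities-0641`).

Setting: `K` a field, `O ⊆ K` a valuation ring, `R 0 → R 1 → ⋯` the sequence of quadratic
transforms along `O` of a two-dimensional regular local ring `R 0` of `K` dominated by `O`, all
members rich in `ℤ`-derivations, the one-dimensional prime quotients of `R 0` Japanese. For
`f ∈ R 0` with non-zero content ideal `J(f) = Ideal.span {δ f | δ ∈ Der_ℤ(R 0)}` we reach, at
some stage `i`, either a member of dimension `≤ 1` or Giraud's condition `(*)`: a regular system
of parameters `u = (u 0, u 1)` of `R i` (a CORNER, full boundary) in which the logarithmic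
content ideal of `f_i` is `(u 0 ^ N 0 · u 1 ^ N 1) · J₀` with `J₀` of finite colength.

Proof. Write `J(f) = (g₀) · J₀` with `J₀` of finite colength (`exists_eq_span_singleton_mul_forall_not_le`,
`isFiniteLength_quotient_of_forall_not_le`) and let `x₀ ∈ 𝔪_0` be the exceptional parameter.
By the embedded resolution of the plane curve germ `b = x₀ g₀` along `O`
(`stub_curveMonomialization`) some `R i` is of dimension `≤ 1` or two-dimensional with
`b = w · u 0 ^ M 0 · u 1 ^ M 1`, `w` a unit, `u` a regular system of parameters. Along the
sequence the dimension is `2` or the member is a valuation ring (`mem_or_inv_mem_or_isRegularLocalRing`),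
hence of dimension `≤ 1`; so either we are done or `R 0, …, R i` are all two-dimensional. Then,
by the support transfer along the sequence (induction on the stage: the sandwich
`content_empty_quadraticTransform_sandwich` plus `prime_quadraticTransform_dichotomy`; the same
argument as the landed `content_support_along_sequence`), every non-maximal prime of `R i`
containing `J(f_i) ≠ 0` contains `b`, so every prime element `p` with `C_u(f_i) ⊆ (p)` (the
logarithmic content,
`C_u(f_i) ⊇ u 0 u 1 · J(f_i)`) divides `u 0` or `u 1`, i.e. generates `(u 0)` or `(u 1)`, and the
gcd bookkeeping (`exists_eq_span_prod_pow_mul_of_forall_prime`) gives `C_u(f_i) = (u ^ N) · J₀'`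
with `J₀'` of finite colength.

References: J. Giraud, *Forme normale d'une fonction sur une surface de caractéristique
positive*, Bull. SMF 111 (1983), Thm. 2.4 (proof, first phase).
-/

set_option linter.dupNamespace false

noncomputable section

open IsLocalRing Literature.AlgebraicGeometry.Resolution

namespace Summit.ResolutionOfSingularities.ResolutionOfSingularities.Theorems.PfaffLine

section PhaseOne

variable {K : Type} [Field K]

/-- **A regular local subring of `K` which is a valuation ring of `K` has dimension `≤ 1`**: a
Noetherian valuation ring is a principal ideal ring (`tfae_of_isNoetherianRing_of_isLocalRing_of_isDomain`),
hence of Krull dimension `≤ 1`. [folklore] -/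
theorem ringKrullDim_le_one_of_mem_or_inv_mem_phaseOne {S : Subring K} [IsRegularLocalRing S]
    (hval : ∀ z : K, z ∈ S ∨ z⁻¹ ∈ S) : ringKrullDim S ≤ 1 := by
  haveI : ValuationRing S := by
    refine { cond' := fun a c => ?_ }
    rcases hval ((a : K) / c) with hz | hz
    · by_cases hc0 : (c : K) = 0
      · exact ⟨0, Or.inl (Subtype.ext (by simp [hc0]))⟩
      · refine ⟨⟨_, hz⟩, Or.inr (Subtype.ext ?_)⟩
        change (c : K) * (a / c) = a
        field_simp
    · by_cases ha : (a : K) = 0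
      · exact ⟨0, Or.inr (Subtype.ext (by simp [ha]))⟩
      · refine ⟨⟨_, hz⟩, Or.inl (Subtype.ext ?_)⟩
        change (a : K) * ((a : K) / c)⁻¹ = c
        by_cases hc0 : (c : K) = 0
        · simp [hc0]
        · field_simp
  haveI : IsPrincipalIdealRing S :=
    ((tfae_of_isNoetherianRing_of_isLocalRing_of_isDomain S).out 0 1).mpr ‹_›
  exact Ring.krullDimLE_iff.mp inferInstance

/-- **Dimension dichotomy along the quadratic sequence.** Along the sequence of quadratic
transforms along `O` of a two-dimensional regular local ring `R 0` of `K` dominated by `O`,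
every member is two-dimensional or a valuation ring of `K`: a quadratic transform of a
two-dimensional regular local ring of `K` is a valuation ring of `K` or again two-dimensional
regular (`IsQuadraticTransform.mem_or_inv_mem_or_isRegularLocalRing`), and an overring of a
valuation ring of `K` inside `K` is one. [folklore] -/
theorem ringKrullDim_eq_two_or_mem_or_inv_mem_phaseOne {O : ValuationSubring K}
    {R : ℕ → Subring K} (hreg : IsRegularLocalRing (R 0)) (hdim : ringKrullDim (R 0) = 2)
    (hof : IsLocalRingOf (R 0)) (h0 : SubringDominates (R 0) O.toSubring)
    (hstep : ∀ i, IsQuadraticTransformAlong O (R i) (R (i + 1))) (j : ℕ) :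
    ringKrullDim (R j) = 2 ∨ ∀ z : K, z ∈ R j ∨ z⁻¹ ∈ R j := by
  haveI := isRegularLocalRing_sequence hreg hstep
  induction j with
  | zero => exact Or.inl hdim
  | succ j ih =>
    rcases ih with h2 | hval
    · have hofj : IsLocalRingOf (R j) :=
        isLocalRingOf_of_le hof (sequence_monotone hstep (Nat.zero_le j))
      rcases ((hstep j).isQuadraticTransform
          (sequence_dominates h0 hstep j).1).mem_or_inv_mem_or_isRegularLocalRing h2 hofj with
        h | h
      · exact Or.inr h
      · exact Or.inl h.2
    · exact Or.inr fun z => (hval z).imp (fun h => (hstep j).le h) fun h => (hstep j).le h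

end PhaseOne

open IsLocalRing

/-- **Registered stub `giraud_phase_one`** (P1: phase one of Giraud's Théorème 2.4 along the
quadratic sequence). Along the sequence `R 0 → R 1 → ⋯` of quadratic transforms along `O'` of a
two-dimensional regular local ring `R 0` of `K'` dominated by `O'` (one-dimensional prime
quotients of `R 0` Japanese, all members rich in `ℤ`-derivations with dual bases), for `f ∈ R 0`
with non-zero content ideal `Ideal.span {δ f | δ}` there is a stage `i` at which either
`dim R i ≤ 1` or Giraud's condition `(*)` holds: a regular system of parameters `u` of `R i`
(full boundary) with logarithmic content ideal of `f_i` equal to `(u 0 ^ N 0 · u 1 ^ N 1) · J₀`,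
`J₀` of finite colength. Proof: monomialize the curve `x₀ g₀ = 0` (`g₀` the divisorial part of
the content ideal, `x₀` the exceptional parameter) along the sequence
(`stub_curveMonomialization`); at that stage every prime curve in the support of the content
ideal is a component of `x₀ g₀ = 0` (support transfer, stage by stage), hence a boundary
curve, and the gcd bookkeeping (`exists_eq_span_prod_pow_mul_of_forall_prime`) concludes.
[cite: Giraud1983, Thm. 2.4 (proof)] -/
theorem giraud_phase_one : ∀ {K' : Type} [Field K'] (O' : ValuationSubring K') (R : ℕ → Subring K'), IsRegularLocalRing (R 0) → ringKrullDim (R 0) = 2 → Literature.AlgebraicGeometry.Resolution.IsLocalRingOf (R 0) → Literature.AlgebraicGeometry.Resolution.SubringDominates (R 0) O'.toSubring → ∀ (hstep : ∀ i, Literature.AlgebraicGeometry.Resolution.IsQuadraticTransformAlong O' (R i) (R (i + 1))), (∀ (𝔮 : Ideal (R 0)) (L : Type) [Field L] [Algebra (R 0 ⧸ 𝔮) L] [IsFractionRing (R 0 ⧸ 𝔮) L], 𝔮.IsPrime → ringKrullDim (R 0 ⧸ 𝔮) = 1 → Module.Finite (R 0 ⧸ 𝔮) (integralClosure (R 0 ⧸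 𝔮) L)) → (∀ (i : ℕ) (N : Type) [CommRing N] (ψ : R i →+* N) (δ₀ : R i →+ N), (∀ a b, δ₀ (a * b) = ψ a * δ₀ b + ψ b * δ₀ a) → ∀ Y : Finset (R i), ∃ (m : ℕ) (Δ : Fin m → Derivation ℤ (R i) (R i)) (nn : Fin m → N), ∀ y ∈ Y, δ₀ y = Finset.univ.sum fun j => ψ (Δ j y) * nn j) → (∀ (i : ℕ) (v : Fin 2 → R i), (∀ z : R i, z ∈ Ideal.span (Set.range v) ↔ ¬ IsUnit z) → ∃ D : Fin 2 → Derivation ℤ (R i) (R i), ∀ l j, D l (v j) = if l = j then 1 else 0) → ∀ (f : R 0), Ideal.span {b | ∃ δ : Derivation ℤ (R 0) (R 0), δ f = b} ≠ ⊥ → ∃ i : ℕ, ringKrullDim (R i) ≤ 1 ∨ ∃ (u : Fin 2 → R i) (N : Fin 2 → ℕ) (J₀ : Ideal (R i)), (∀ z : R i, z ∈ Ideal.span (Set.range u) ↔ ¬ IsUnit z) ∧ Ideal.span {b | ∃ δ : Derivation ℤ (R i) (R i), (∀ l ∈ (Finset.univ : Finset (Fin 2)), δ (u l) ∈ Ideal.span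 {u l}) ∧ δ (Subring.inclusion (Literature.AlgebraicGeometry.Resolution.sequence_monotone hstep (Nat.zero_le i)) f) = b} = Ideal.span {Finset.univ.prod fun l => u l ^ N l} * J₀ ∧ IsFiniteLength (R i) (R i ⧸ J₀) := by
  intro K _ O R hreg0 hdim0 hof0 h0 hstep hfin hrich _ f hJne
  classical
  have hregi : ∀ i, IsRegularLocalRing (R i) := isRegularLocalRing_sequence hreg0 hstep
  haveI := hregi
  -- the exceptional parameter `x₀ ∈ 𝔪_0` (of minimal value)
  obtain ⟨_, x₀, hx₀m, hx₀0, -, -⟩ := (hstep 0).exists_eq_locAtCentre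
  have hx₀ : ¬ IsUnit x₀ := mem_nonunits_iff.mp ((IsLocalRing.mem_maximalIdeal x₀).mp hx₀m)
  -- `J(f) = (g₀) · J₀` with `J₀` in no proper principal ideal
  obtain ⟨g₀, J₀, hg0, hJ, hJ₀⟩ := exists_eq_span_singleton_mul_forall_not_le _ hJne
  -- monomialize the curve `b = x₀ g₀` along the sequence
  have hb0 : ((x₀ * g₀ : R 0) : K) ≠ 0 := fun e =>
    mul_ne_zero hx₀0 hg0 (ZeroMemClass.coe_eq_zero.mp e)
  obtain ⟨i, -, d, u, M, w, hw, hu, hdimd, hb⟩ :=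
    stub_curveMonomialization K O R hreg0 hdim0 hof0 h0 hstep hfin 0 _ (x₀ * g₀).2 hb0
  -- the content ideal with EMPTY boundary condition is the full content ideal
  have hempty : ∀ (S : Subring K) (v : Fin 0 → S) (g : S),
      Ideal.span {b | ∃ δ : Derivation ℤ S S,
          (∀ l ∈ (∅ : Finset (Fin 0)), δ (v l) ∈ Ideal.span {v l}) ∧ δ g = b} =
        Ideal.span {b | ∃ δ : Derivation ℤ S S, δ g = b} := by
    intro S v g
    congr 1
    ext b
    exact exists_congr fun δ => and_iff_right fun l hl => absurd hl (Finset.notMem_empty l)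
  -- ONE STEP of the support transfer along `R i → R (i + 1)`: with `x ∈ 𝔪_i` the exceptional
  -- parameter, the sandwich `(x) J(g) R_{i+1} ⊆ J(g')` (`g'` the image of `g`) gives
  -- `J(g') ≠ 0`, and a prime `𝔭 ≠ 𝔪_{i+1}` over `J(g')` either contains `x`, whence
  -- `𝔭 ∩ R i = 𝔪_i ∋ c`, or contracts to a prime `≠ 𝔪_i` over `J(g)` (prime dichotomy)
  have step : ∀ i : ℕ, ringKrullDim (R i) = 2 → ∀ g c : R i, c ∈ maximalIdeal (R i) →
      Ideal.span {b | ∃ δ : Derivation ℤ (R i) (R i), δ g = b} ≠ ⊥ →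
      (∀ 𝔭 : Ideal (R i), 𝔭.IsPrime → 𝔭 ≠ maximalIdeal (R i) →
        Ideal.span {b | ∃ δ : Derivation ℤ (R i) (R i), δ g = b} ≤ 𝔭 → c ∈ 𝔭) →
      Ideal.span {b | ∃ δ : Derivation ℤ (R (i + 1)) (R (i + 1)),
          δ (Subring.inclusion (hstep i).le g) = b} ≠ ⊥ ∧
        ∀ 𝔭 : Ideal (R (i + 1)), 𝔭.IsPrime → 𝔭 ≠ maximalIdeal (R (i + 1)) →
          Ideal.span {b | ∃ δ : Derivation ℤ (R (i + 1)) (R (i + 1)),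
              δ (Subring.inclusion (hstep i).le g) = b} ≤ 𝔭 →
            Subring.inclusion (hstep i).le c ∈ 𝔭 := by
    intro i hdimi g c hc hJ0 hJ
    obtain ⟨_, x, hxm, hx0, hminx, -⟩ := (hstep i).exists_eq_locAtCentre
    have hinj : Function.Injective (Subring.inclusion (hstep i).le) :=
      Subring.inclusion_injective (hstep i).le
    obtain ⟨v⟩ : Nonempty (Fin 0 → R i) := ⟨fun l => l.elim0⟩
    obtain ⟨v'⟩ : Nonempty (Fin 0 → R (i + 1)) := ⟨fun l => l.elim0⟩
    have hT6 := content_empty_quadraticTransform_sandwich O (R i) (R (i + 1)) (hstep i) (hrich i)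
      v (fun l => l.elim0) (fun l => l.elim0) v' x hxm g
    rw [hempty (R i) v g, hempty (R (i + 1)) v' (Subring.inclusion (hstep i).le g)] at hT6
    obtain ⟨hlow, -⟩ := hT6
    have hmapne : (Ideal.span {b | ∃ δ : Derivation ℤ (R i) (R i), δ g = b}).map
        (Subring.inclusion (hstep i).le) ≠ ⊥ := by
      rw [Ne, Ideal.map_eq_bot_iff_of_injective hinj]
      exact hJ0
    have hxne : Ideal.span {Subring.inclusion (hstep i).le x} ≠ ⊥ := by
      rw [Ne, Ideal.span_singleton_eq_bot]
      exact fun e => hx0 (hinj (by rw [e, map_zero]))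
    have hJ1ne : Ideal.span {b | ∃ δ : Derivation ℤ (R (i + 1)) (R (i + 1)),
        δ (Subring.inclusion (hstep i).le g) = b} ≠ ⊥ := by
      intro hbot
      rw [hbot, le_bot_iff, Ideal.mul_eq_bot] at hlow
      exact hlow.elim hxne hmapne
    refine ⟨hJ1ne, fun 𝔭 h𝔭 h𝔭m hJ𝔭 => ?_⟩
    haveI := h𝔭
    have hP := prime_quadraticTransform_dichotomy O (R i) (R (i + 1)) (hstep i) hdimi
      (sequence_dominates h0 hstep i).1 x hxm hminx 𝔭 h𝔭 h𝔭m
    by_cases hx𝔭 : Subring.inclusion (hstep i).le x ∈ 𝔭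
    · -- the exceptional curve: `𝔭 ∩ R i = 𝔪_i ∋ c`
      have hc' : c ∈ 𝔭.comap (Subring.inclusion (hstep i).le) := by
        rw [(hP.1 hx𝔭).2]
        exact hc
      exact Ideal.mem_comap.mp hc'
    · -- a strict transform: `J(g) ⊆ 𝔭 ∩ R i`, a prime `≠ 𝔪_i`
      have h𝔭0 : 𝔭 ≠ ⊥ := fun e => hJ1ne (le_bot_iff.mp (e ▸ hJ𝔭))
      have hcm : 𝔭.comap (Subring.inclusion (hstep i).le) ≠ maximalIdeal (R i) :=
        (hP.2 hx𝔭 h𝔭0).1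
      have hle : Ideal.span {b | ∃ δ : Derivation ℤ (R i) (R i), δ g = b} ≤
          𝔭.comap (Subring.inclusion (hstep i).le) := by
        rw [← Ideal.map_le_iff_le_comap]
        refine ((Ideal.IsPrime.mul_le h𝔭).mp (hlow.trans hJ𝔭)).resolve_left fun hx => hx𝔭 ?_
        exact hx (Ideal.mem_span_singleton_self _)
      exact Ideal.mem_comap.mp (hJ _ (Ideal.comap_isPrime _ 𝔭) hcm hle)
  -- `(x₀ g₀)_i ∈ 𝔪_i`: non-units of `R 0` stay non-units (domination)
  have hcm : ∀ i, Subring.inclusion (sequence_monotone hstep (Nat.zero_le i)) (x₀ * g₀) ∈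
      maximalIdeal (R i) := fun i => by
    rw [map_mul]
    refine Ideal.mul_mem_right _ _
      ((IsLocalRing.mem_maximalIdeal _).mpr (mem_nonunits_iff.mpr fun hu => hx₀ ?_))
    rw [isUnit_subring_iff_inv_mem] at hu ⊢
    exact ⟨hu.1, (sequence_dominates h0 hstep i).2.2 _ x₀.2 hu.2⟩
  -- `J(f_i) ≠ 0` and its support, as long as the members stay two-dimensional
  have key : ∀ i : ℕ, (∀ j, j ≤ i → ringKrullDim (R j) = 2) →
      Ideal.span {b | ∃ δ : Derivation ℤ (R i) (R i),
          δ (Subring.inclusion (sequence_monotone hstep (Nat.zero_le i)) f) = b} ≠ ⊥ ∧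
        ∀ 𝔭 : Ideal (R i), 𝔭.IsPrime → 𝔭 ≠ maximalIdeal (R i) →
          Ideal.span {b | ∃ δ : Derivation ℤ (R i) (R i),
              δ (Subring.inclusion (sequence_monotone hstep (Nat.zero_le i)) f) = b} ≤ 𝔭 →
            Subring.inclusion (sequence_monotone hstep (Nat.zero_le i)) (x₀ * g₀) ∈ 𝔭 := by
    intro i
    induction i with
    | zero =>
      intro _
      have hf0 : Subring.inclusion (sequence_monotone hstep (Nat.zero_le 0)) f = f :=
        Subtype.ext rfl
      have hc0 : Subring.inclusion (sequence_monotone hstep (Nat.zero_le 0)) (x₀ * g₀) =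
          x₀ * g₀ := Subtype.ext rfl
      rw [hf0, hc0, hJ]
      refine ⟨?_, fun 𝔭 h𝔭 h𝔭m hle => ?_⟩
      · rw [Ne, Ideal.mul_eq_bot, not_or, Ideal.span_singleton_eq_bot]
        exact ⟨hg0, fun e => hJ₀ x₀ hx₀m (by rw [e]; exact bot_le)⟩
      · haveI := h𝔭
        rcases (Ideal.IsPrime.mul_le h𝔭).mp hle with hg | hJ₀𝔭
        · exact Ideal.mul_mem_left _ _ ((Ideal.span_singleton_le_iff_mem _).mp hg)
        · -- `𝔭 ≠ 𝔪` is principal, `𝔭 = (p)`, and `J₀ ⊄ (p)`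
          exfalso
          obtain ⟨p, rfl⟩ := exists_eq_span_singleton_of_ne_maximalIdeal hdim0 𝔭 h𝔭m
          exact hJ₀ p (IsLocalRing.le_maximalIdeal h𝔭.ne_top (Ideal.mem_span_singleton_self p))
            hJ₀𝔭
    | succ i ih =>
      intro hdims
      obtain ⟨ih0, ih𝔭⟩ := ih fun j hj => hdims j (hj.trans (Nat.le_succ i))
      have hfi : Subring.inclusion (sequence_monotone hstep (Nat.zero_le (i + 1))) f =
          Subring.inclusion (hstep i).le
            (Subring.inclusion (sequence_monotone hstep (Nat.zero_le i)) f) :=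
        Subtype.ext rfl
      have hci : Subring.inclusion (sequence_monotone hstep (Nat.zero_le (i + 1))) (x₀ * g₀) =
          Subring.inclusion (hstep i).le
            (Subring.inclusion (sequence_monotone hstep (Nat.zero_le i)) (x₀ * g₀)) :=
        Subtype.ext rfl
      rw [hfi, hci]
      exact step i (hdims i (Nat.le_succ i)) _ _ (hcm i) ih0 ih𝔭
  by_cases hall : ∀ j, j ≤ i → ringKrullDim (R j) = 2
  swap
  · -- some earlier member is a valuation ring of `K`: dimension `≤ 1`
    push Not at hall
    obtain ⟨j, -, hj⟩ := hall
    rcases ringKrullDim_eq_two_or_mem_or_inv_mem_phaseOne hreg0 hdim0 hof0 h0 hstep j with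
      h | hval
    · exact absurd h hj
    · exact ⟨j, Or.inl (ringKrullDim_le_one_of_mem_or_inv_mem_phaseOne hval)⟩
  -- all of `R 0, …, R i` are two-dimensional: `d = 2`
  have hdimS : ringKrullDim (R i) = 2 := hall i le_rfl
  have hd2 : d = 2 := by
    have e := hdimd.symm.trans hdimS
    exact_mod_cast e
  subst hd2
  -- the regular system of parameters `u`
  have hu' : Ideal.span (Set.range u) = maximalIdeal (R i) :=
    Ideal.ext fun z => by rw [hu z, IsLocalRing.mem_maximalIdeal, mem_nonunits_iff]
  have hrange : Set.range u = {u 0, u 1} := by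
    ext z
    constructor
    · rintro ⟨l, rfl⟩
      exact (Fin.forall_fin_two (p := fun l => u l ∈ ({u 0, u 1} : Set (R i)))).mpr
        ⟨Set.mem_insert _ _, Set.mem_insert_of_mem _ rfl⟩ l
    · rintro (rfl | rfl)
      exacts [⟨0, rfl⟩, ⟨1, rfl⟩]
  have hm : maximalIdeal (R i) = Ideal.span {u 0, u 1} := by
    rw [← hu', hrange]
  have hm' : maximalIdeal (R i) = Ideal.span {u 1, u 0} := by rw [hm, Set.pair_comm]
  have hulm : ∀ l, u l ∈ maximalIdeal (R i) := fun l => by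
    rw [← hu']
    exact Ideal.subset_span ⟨l, rfl⟩
  have hprime : ∀ l, Prime (u l) :=
    Fin.forall_fin_two.mpr
      ⟨IsRegularLocalRing.prime_of_not_mem_sq (hulm 0)
          (CurveMono.not_mem_sq_of_span_pair hdimS hm),
        IsRegularLocalRing.prime_of_not_mem_sq (hulm 1)
          (CurveMono.not_mem_sq_of_span_pair hdimS hm')⟩
  have hdvd : ∀ l, u l ∣ u 0 * u 1 := fun l => by
    have := Finset.dvd_prod_of_mem u (Finset.mem_univ l)
    rwa [Fin.prod_univ_two] at this
  -- `b_i = (∏ u ^ M) * w` in `R i`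
  have hbi : Subring.inclusion (sequence_monotone hstep (Nat.zero_le i)) (x₀ * g₀) =
      (Finset.univ.prod fun j => u j ^ M j) * w := by
    apply Subtype.ext
    rw [Subring.coe_inclusion]
    exact_mod_cast hb
  -- the support of `J(f_i)` and `J(f_i) ≠ 0`
  obtain ⟨hJi, hsupp⟩ := key i hall
  -- `u 0 u 1 · δ` is logarithmic along the full boundary
  have hmemJ' : ∀ δ : Derivation ℤ (R i) (R i),
      u 0 * u 1 * δ (Subring.inclusion (sequence_monotone hstep (Nat.zero_le i)) f) ∈
        Ideal.span {b | ∃ δ : Derivation ℤ (R i) (R i),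
          (∀ l ∈ (Finset.univ : Finset (Fin 2)), δ (u l) ∈ Ideal.span {u l}) ∧
            δ (Subring.inclusion (sequence_monotone hstep (Nat.zero_le i)) f) = b} := by
    intro δ
    refine Ideal.subset_span ⟨(u 0 * u 1) • δ, fun l _ => ?_, ?_⟩
    · rw [Derivation.smul_apply, smul_eq_mul]
      exact Ideal.mem_span_singleton.mpr (Dvd.dvd.mul_right (hdvd l) _)
    · rw [Derivation.smul_apply, smul_eq_mul]
  obtain ⟨δ₁, hδ₁⟩ : ∃ δ : Derivation ℤ (R i) (R i),
      δ (Subring.inclusion (sequence_monotone hstep (Nat.zero_le i)) f) ≠ 0 := by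
    by_contra hcon
    push Not at hcon
    refine hJi (Ideal.span_eq_bot.mpr ?_)
    rintro _ ⟨δ, rfl⟩
    exact hcon δ
  have hJ'ne : Ideal.span {b | ∃ δ : Derivation ℤ (R i) (R i),
      (∀ l ∈ (Finset.univ : Finset (Fin 2)), δ (u l) ∈ Ideal.span {u l}) ∧
        δ (Subring.inclusion (sequence_monotone hstep (Nat.zero_le i)) f) = b} ≠ ⊥ := by
    intro e
    have h1 := hmemJ' δ₁
    rw [e, Ideal.mem_bot] at h1
    exact mul_ne_zero (mul_ne_zero (hprime 0).ne_zero (hprime 1).ne_zero) hδ₁ h1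
  -- every prime element over the logarithmic content generates a boundary curve
  have hP : ∀ p : R i, Prime p →
      Ideal.span {b | ∃ δ : Derivation ℤ (R i) (R i),
        (∀ l ∈ (Finset.univ : Finset (Fin 2)), δ (u l) ∈ Ideal.span {u l}) ∧
          δ (Subring.inclusion (sequence_monotone hstep (Nat.zero_le i)) f) = b} ≤
        Ideal.span {p} →
      Ideal.span {p} = Ideal.span {u 0} ∨ Ideal.span {p} = Ideal.span {u 1} := by
    intro p hp hle
    by_contra hne
    rw [not_or] at hne
    have hndvd : ∀ l, ¬ p ∣ u l :=
      Fin.forall_fin_two.mpr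
        ⟨fun h => hne.1 (Ideal.span_singleton_eq_span_singleton.mpr
            (hp.associated_of_dvd (hprime 0) h)),
          fun h => hne.2 (Ideal.span_singleton_eq_span_singleton.mpr
            (hp.associated_of_dvd (hprime 1) h))⟩
    -- `J(f_i) ⊆ (p)`
    have hJile : Ideal.span {b | ∃ δ : Derivation ℤ (R i) (R i),
        δ (Subring.inclusion (sequence_monotone hstep (Nat.zero_le i)) f) = b} ≤
          Ideal.span {p} := by
      rw [Ideal.span_le]
      rintro _ ⟨δ, rfl⟩
      have h1 := hle (hmemJ' δ)
      rw [SetLike.mem_coe, Ideal.mem_span_singleton]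
      rw [Ideal.mem_span_singleton] at h1
      rcases hp.dvd_or_dvd h1 with h2 | h2
      · exact absurd h2 fun h2 => (hp.dvd_or_dvd h2).elim (hndvd 0) (hndvd 1)
      · exact h2
    -- `(p)` is a non-maximal prime containing `J(f_i)`, hence contains `b_i`
    have hbip := hsupp (Ideal.span {p}) ((Ideal.span_singleton_prime hp.ne_zero).mpr hp)
      (maximalIdeal_ne_span_singleton hdimS p).symm hJile
    rw [hbi, Ideal.mem_span_singleton] at hbip
    rcases hp.dvd_or_dvd hbip with h3 | h3
    · rw [Fin.prod_univ_two] at h3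
      rcases hp.dvd_or_dvd h3 with h4 | h4
      · exact hndvd 0 (hp.dvd_of_dvd_pow h4)
      · exact hndvd 1 (hp.dvd_of_dvd_pow h4)
    · exact hp.not_unit (isUnit_of_dvd_unit h3 hw)
  obtain ⟨N, J₀', hJ'eq, hfin'⟩ :=
    exists_eq_span_prod_pow_mul_of_forall_prime hdimS u hu' _ hJ'ne hP
  exact ⟨i, Or.inr ⟨u, N, J₀', hu, hJ'eq, hfin'⟩⟩

end Summit.ResolutionOfSingularities.ResolutionOfSingularities.Theorems.PfaffLine

end
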